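import Literature.Probability.LatticeModels.MedialCycleSeparation
import Literature.Probability.LatticeModels.FKIsingBarObservable
import HarnessLib

/-!
# The FK interface passes the free-arc dart of every site joined to the wired arc

Topic `Literature/Probability/LatticeModels`; part of the discharge programme for the named fact
`fkIsing_rsw` (DCHN 2011 Thm. 1 / DCS 2012 Thm. 3.16), first instalment of the *upper*
comparability of Duminil-Copin–Hongler–Nolin's Lemma 12 ("`e` belongs to `γ` if and only if `x`
is connected to the wired arc", p. 12 of arXiv:0912.4253; Duminil-Copin–Smirnov 2012, proof of
Prop. 7.8). Theorems only (one auxiliary configuration-free relation `FreeSideAdj`); no named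
fact. The "if" half (`openJoinedToArcA_of_mem_fkInterface`, `FKIsingBarObservable.lean`) is in
the tree; this file proves the "only if" half:

* `exists_lt_exitTime_cornerOrbit_eq`: for admissible data with (H1) (the wired arc connected
  through the domain), a site `x` joined to the arc `A` by open edges of the completed
  configuration, and a corner `(x, k)` with inner face joined to the face of the start corner by
  a chain of adjacent faces with closed common sides, the interface visits `(x, k)` before its
  exit;
* `cSrc_mem_fkInterface_iff_openJoinedToArcA`, `real_cSrc_mem_fkInterface_eq_openJoined`: for a
  dart whose source edge ends on the free arc `B` (and a `FreeSideAdj`-chain, which holds along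
  the free arc), `e ∈ γ ↔ x ↔ A` and `P(e ∈ γ) = P(x ↔ A)`.

## The proof (planar topology of the loop representation, via the tree's perturbed polygons)

The orbit of the start corner under the injective turning rule `nextCorner β` stays in the finite
domain, hence is a cycle of `ℤ²` (`exists_cornerOrbit_startCorner_eq`); take its minimal period
`n + 1` and the closed perturbed polygon `cyLoop` of `MedialCycleSeparation.lean`. By the argument
of `medialCycle_separates_holds`, part (A), the winding numbers of the polygon about the start
vertex `a` and about the centre of the start face differ (`wind_cyLoop_fst_ne_faceCenter`: the
first dart piece crosses the half-diagonal of the start corner once, transversally). The winding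
number is constant along open edges (`wind_cyLoop_eq_of_reachable`), so equal at `x` and at `a`
((H1) makes the arc `A` one open cluster); it is constant across a closed common side of two
adjacent faces (`wind_cyLoop_faceCenter_eq_of_adj`, new: dart pieces and vertex connectors miss
all centre segments, and a face connector meets one only when it runs along the followed — open —
side, `fConn_shape`/`FConnShape.centerSeg_faces`), so equal at the centres of the start face and
of `faceAt x k`. If no corner of the cycle were `(x, k)`, its half-diagonal would be missed and
the winding numbers about `x` and about the centre of `faceAt x k` would agree
(`wind_cyLoop_eq_faceCenter_of_forall_ne`) — a contradiction. Finally the visit happens before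
the exit: a passage of the cycle from a non-inner to an inner face is the crossing of a sourced
`A`–`B` edge at its `A`-end, i.e. happens at the (unique) start corner
(`cornerOrbit_eq_startCorner_of_reentry`, `not_isInnerFace_of_exitTime_le`).

## References

* H. Duminil-Copin, C. Hongler, P. Nolin, *Connection probabilities and RSW-type bounds for the
  two-dimensional FK Ising model*, Comm. Pure Appl. Math. 64 (2011) 1165–1198 (arXiv:0912.4253),
  §4, Lemma 12. [DuminilCopinHonglerNolin2011]
* H. Duminil-Copin, S. Smirnov, *Conformal invariance of lattice models*, Clay Math. Proc. 15
  (2012), Prop. 7.8. [DuminilCopinSmirnov2012Clay]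
* S. Smirnov, *Critical percolation in the plane*, C. R. Acad. Sci. Paris 333 (2001), §2 (the
  exploration process); *Conformal invariance in random cluster models I*, Ann. Math. 172 (2010),
  §4. [Smirnov2001, Smirnov2010]
-/

noncomputable section

open Set Complex Literature.Topology.PlaneTopology

namespace Literature.Probability.LatticeModels

/-! ### Iterates of the turning rule -/

section Iterates

variable (β : Percolation.BondConfig (Site 2))

/-- The orbit from an orbit point: `orb_c (a + b) = orb_{orb_c a} b`. [folklore] -/
theorem cornerOrbit_add' (c : Site 2 × Fin 4) (a b : ℕ) :
    cornerOrbit β c (a + b) = cornerOrbit β (cornerOrbit β c a) b := by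
  induction b with
  | zero => rfl
  | succ b ih => rw [Nat.add_succ]; change nextCorner β _ = nextCorner β _; rw [ih]

/-- The `b`-th iterate of the turning rule is injective. [folklore] -/
theorem cornerOrbit_injective_left (b : ℕ) : Function.Injective fun c : Site 2 × Fin 4 ↦ cornerOrbit β c b := by
  induction b with
  | zero => exact fun c c' h ↦ h
  | succ b ih =>
    intro c c' h
    exact ih (nextCorner_injective h)

/-- **An orbit confined to a finite set of corners is periodic** (the turning rule is injective).
[folklore] -/
theorem exists_cornerOrbit_eq_self_of_finite {T : Set (Site 2 × Fin 4)} (hT : T.Finite) {c : Site 2 × Fin 4}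
    (hmem : ∀ n, cornerOrbit β c n ∈ T) : ∃ P, 0 < P ∧ cornerOrbit β c P = c := by
  obtain ⟨i, j, hij, h⟩ := Set.Finite.exists_lt_map_eq_of_forall_mem (f := fun n : ℕ ↦ cornerOrbit β c n) hmem hT
  refine ⟨j - i, by omega, ?_⟩
  have hj : cornerOrbit β c j = cornerOrbit β (cornerOrbit β c (j - i)) i := by
    rw [← cornerOrbit_add']; congr 1; omega
  rw [hj] at h
  exact (cornerOrbit_injective_left β i h).symm

end Iterates

/-! ### Winding numbers of the closed polygon of a cycle -/

section CycleWinding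

variable {β : Percolation.BondConfig (Site 2)} {q : Site 2 × Fin 4} {n : ℕ}

/-- **The cycle separates its own first corner from its face**: for a cycle of minimal period
`n + 1` through `q = (v, k)`, the winding numbers of its closed perturbed polygon about `v` and
about the centre of the face of `q` differ (the first dart piece crosses the half-diagonal of `q`
once, transversally; no other piece meets it). [folklore] -/
theorem wind_cyLoop_fst_ne_faceCenter (hP : cornerOrbit β q (n + 1) = q)
    (hPmin : ∀ s, 0 < s → s < n + 1 → cornerOrbit β q s ≠ q) :
    wind (fun t => (cyLoop n hP).extend t - Site.toComplex q.1) ≠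
      wind (fun t => (cyLoop n hP).extend t - faceCenter (cFace q)) := by
  set γ := cyLoop (β := β) (q := q) n hP with hγ
  set ℓ := Site.toComplex q.1 with hℓ
  set r := faceCenter (cFace q) with hr
  have hfq : cFace q = faceAt q.1 q.2 := rfl
  have hhalf : halfDiag q.1 (faceAt q.1 q.2) = segment ℝ ℓ r := rfl
  have hd : ∀ j, 1 ≤ j → j ≤ n → ∀ z ∈ cyDart β q j, z ∉ segment ℝ ℓ r := by
    intro j hj1 hjn z hz hz'
    rw [← hhalf] at hz'
    have := cy_eq_of_mem_halfDiag j hz hz'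
    exact hPmin j hj1 (by omega) (this.trans (Prod.ext rfl rfl))
  have hc : ∀ j ≤ n, ∀ z ∈ cyConn β q j, z ∉ segment ℝ ℓ r := by
    intro j _ z hz hz'
    rw [← hhalf] at hz'
    exact cyConn_disjoint_halfDiag j (isCorner_faceAt q.1 q.2) hz hz'
  have hℓγ : ℓ ∉ range γ := not_mem_range_cyLoop hP (fun j _ => toComplex_not_mem_cyDart _ _)
    (fun j _ => toComplex_not_mem_cyConn _ _)
  have hrγ : r ∉ range γ := not_mem_range_cyLoop hP (fun j _ => faceCenter_not_mem_cyDart _ _)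
    (fun j _ => faceCenter_not_mem_cyConn _ _)
  have hcross : γ.crossInc ℓ r ≠ 0 := by
    rw [hγ, crossInc_cyLoop_eq n hP hd hc (toComplex_not_mem_cyDart _ _) (faceCenter_not_mem_cyDart _ _)]
    have key := crossInc_dartSeg_ne_zero (isCorner_faceAt q.1 q.2)
    have h01 : ∀ v f : Site 2, (srcDir v f = 0 ∧ tgtDir v f = 1) ∨ (srcDir v f = 1 ∧ tgtDir v f = 0) := by
      intro v f; unfold srcDir tgtDir; split_ifs <;> simp
    rcases h01 (cyV β q 0) (cyF β q 0) with ⟨h0, h1⟩ | ⟨h0, h1⟩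
    · rw [cyS, cyT, h0, h1]; exact key
    · rw [cyS, cyT, h0, h1, ← Path.segment_symm, Path.crossInc_symm]
      · exact neg_ne_zero.2 key
      · rw [Path.range_segment]; exact fun h' => toComplex_not_mem_dartSeg (isCorner_faceAt q.1 q.2) h'
      · rw [Path.range_segment]; exact fun h' => faceCenter_not_mem_dartSeg (isCorner_faceAt q.1 q.2) h'
  intro hw
  rw [Path.crossInc_loop γ hℓγ hrγ, hw, sub_self, zero_mul] at hcross
  exact hcross rfl

/-- **A corner off the cycle is not separated from its face**: if no corner of the cycle is
`(v, k)`, the winding numbers about `v` and about the centre of `faceAt v k` agree (the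
half-diagonal of `(v, k)` misses the polygon). [folklore] -/
theorem wind_cyLoop_eq_faceCenter_of_forall_ne (hP : cornerOrbit β q (n + 1) = q) {v : Site 2} {k : Fin 4}
    (hne : ∀ m ≤ n, cornerOrbit β q m ≠ (v, k)) :
    wind (fun t => (cyLoop n hP).extend t - Site.toComplex v) =
      wind (fun t => (cyLoop n hP).extend t - faceCenter (faceAt v k)) := by
  refine wind_cyLoop_eq_of_segment hP fun z hz => not_mem_range_cyLoop hP (fun j hj hzj => ?_) (fun j _ hzj => ?_)
  · exact hne j hj (cy_eq_of_mem_halfDiag j hzj hz)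
  · exact cyConn_disjoint_halfDiag j (isCorner_faceAt v k) hzj hz

/-- **Across a closed common side the winding number of the face centres does not change.**
Let `f'`, `g'` be adjacent faces such that no open edge joins two common corners of `f'` and `g'`
(the common side is closed). Then the centre segment `[centre f', centre g']` misses the polygon
— dart pieces and vertex connectors miss all centre segments, and a face connector meets one
only when it runs along the followed (open) side — so the winding numbers about the two centres
agree. [folklore] -/
theorem wind_cyLoop_faceCenter_eq_of_adj (hP : cornerOrbit β q (n + 1) = q) {f' g' : Site 2}
    (hfg : (zdGraph 2).Adj f' g')
    (hclosed : ∀ u w : Site 2, IsCorner u f' → IsCorner u g' → IsCorner w f' → IsCorner w g' → u ≠ w →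
      s(u, w) ∉ β) :
    wind (fun t => (cyLoop n hP).extend t - faceCenter f') =
      wind (fun t => (cyLoop n hP).extend t - faceCenter g') := by
  refine wind_cyLoop_eq_of_segment hP fun z hz => not_mem_range_cyLoop hP (fun j _ hzj => ?_) (fun j _ hzj => ?_)
  · rw [cyDart_eq] at hzj
    exact dartSeg_inter_centerSeg (isCorner_cy j) hfg hzj hz
  · rcases cy_turn_cases (β := β) (q := q) j with ⟨hc, hv, hf, he⟩ | ⟨ho, hf, hv, he⟩
    · -- vertex turn: the connector has the vertex-connector shape
      rcases cyConn_cases j hzj with ⟨I, J, -, -, -, -, -, -, hshape⟩ | ⟨I, J, -, ho, -⟩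
      · exact hshape.not_mem_centerSeg hfg hz
      · exact absurd ho hc
    · -- face turn: the connector runs along the followed open side of the common face
      set v₁ := cyV β q j with hv₁
      set v₂ := cyV β q (j + 1) with hv₂
      set f := cyF β q j with hfdef
      have hne : v₁ ≠ v₂ := fun h => hv h.symm
      obtain ⟨hdir, hvi, hvj⟩ := faceTurn_dirs hne he
      set I := tgtDir v₁ f with hI
      -- the connector as a segment of shifted side points of `f`
      have hconn : cyConn β q j = segment ℝ (dartPt v₁ f I) (dartPt v₂ f I) := by
        rw [cyConn, cyT, cyS]
        change segment ℝ (dartPt v₁ f (tgtDir v₁ f)) (dartPt v₂ (cyF β q (j + 1)) (srcDir v₂ (cyF β q (j + 1)))) = _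
        rw [hf, hdir]
      rw [hconn] at hzj
      obtain ⟨J, hJ⟩ := exists_ne I
      obtain ⟨hshape, hs1, hs2⟩ := fConn_shape (isCorner_cy j) hJ hvi (hvj J hJ) hzj
      obtain ⟨hfI, hgI, hJcases⟩ := hshape.centerSeg_faces (L := v₁ J) hs1 hs2 hfg hz
      -- the followed edge joins two common corners of `f'` and `g'`, and is open
      have hv₁c : IsCorner v₁ f := isCorner_cy j
      have hcu : ∀ h' : Site 2, h' I = f I → (h' J = v₁ J ∨ h' J + 1 = v₁ J) →
          IsCorner v₁ h' ∧ IsCorner (cornerNeighbor v₁ f I) h' := by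
        intro h' hI' hJ'
        constructor
        · intro k
          rcases fin_two_cases_of_ne hJ k with rfl | rfl
          · rw [hI']; exact hv₁c I
          · rcases hJ' with h | h
            · exact Or.inl h.symm
            · exact Or.inr h.symm
        · intro k
          rcases fin_two_cases_of_ne hJ k with rfl | rfl
          · rw [hI']
            simp only [cornerNeighbor, Function.update_self]
            rcases hv₁c I with h | h <;> [right; left] <;> omega
          · rw [cornerNeighbor_apply_of_ne hJ]
            rcases hJ' with h | h
            · exact Or.inl h.symm
            · exact Or.inr h.symm
      have htgt : cTgt (cornerOrbit β q j) = s(v₁, cornerNeighbor v₁ f I) := by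
        rw [← cornerTarget_cFace, cornerTarget_eq_cornerEdge]; rfl
      have hneq : v₁ ≠ cornerNeighbor v₁ f I := by
        intro h
        have := congr_fun h I
        simp only [cornerNeighbor, Function.update_self] at this
        rcases hv₁c I with h' | h' <;> omega
      rcases hJcases with ⟨hgJ, hL⟩ | ⟨hfJ, hL⟩
      · -- `g'` above `f'`, the side is the bottom side of `g'` = top side of `f'`
        obtain ⟨h1, h2⟩ := hcu f' hfI (Or.inr (by omega))
        obtain ⟨h3, h4⟩ := hcu g' hgI (Or.inl hL.symm)
        exact hclosed _ _ h1 h3 h2 h4 hneq (htgt ▸ ho)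
      · obtain ⟨h1, h2⟩ := hcu f' hfI (Or.inl hL.symm)
        obtain ⟨h3, h4⟩ := hcu g' hgI (Or.inr (by omega))
        exact hclosed _ _ h1 h3 h2 h4 hneq (htgt ▸ ho)

end CycleWinding

/-! ### The interface cycle of a Dobrushin domain -/

section Domain

variable {D : DiscreteDobrushin} (hD : D.IsZdAdmissible) (ω : Percolation.BondConfig (Site 2))

/-- The completed configuration consists of lattice edges. [cite: Smirnov2001, §2] -/
theorem bcBondConfig_subset_zdGraph : D.bcBondConfig ω ⊆ (zdGraph 2).edgeSet := by
  intro e he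
  have he' := D.bcBondConfig_subset ω he
  induction e using Sym2.ind with
  | h u w =>
    rw [SimpleGraph.mem_edgeSet] at he' ⊢
    exact meshGraph_le_zdGraph _ _ (discreteDomainGraph_adj_iff.1 he').1

/-- Endpoints of edges of the completed configuration are sites of the domain. [cite: Smirnov2001, §2] -/
theorem mem_meshDomain_of_mem_bcBondConfig {e : Sym2 (Site 2)} (he : e ∈ D.bcBondConfig ω) {x : Site 2}
    (hx : x ∈ e) : x ∈ meshDomain D.Ω D.δ := by
  have he' := D.bcBondConfig_subset ω he
  induction e using Sym2.ind with
  | h u w =>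
    rw [SimpleGraph.mem_edgeSet] at he'
    obtain ⟨-, hu, hw⟩ := discreteDomainGraph_adj_iff.1 he'
    rcases Sym2.mem_iff.1 hx with rfl | rfl
    · exact hu
    · exact hw

include hD in
/-- **The orbit of the start corner is periodic** in `ℤ²`: its left vertices stay in the (finite)
domain and the turning rule is injective. [folklore] -/
theorem exists_cornerOrbit_startCorner_eq : ∃ P, 0 < P ∧
    cornerOrbit (D.bcBondConfig ω) (DiscreteDobrushin.startCorner hD) P = DiscreteDobrushin.startCorner hD := by
  set c₀ := DiscreteDobrushin.startCorner hD
  have hc₀ : D.IsStartCorner c₀ := DiscreteDobrushin.isStartCorner_startCorner hD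
  have hfin : ((meshDomain D.Ω D.δ) ×ˢ (Set.univ : Set (Fin 4))).Finite :=
    (meshDomain_finite hD.isBounded hD.delta_pos).prod Set.finite_univ
  refine exists_cornerOrbit_eq_self_of_finite _ hfin fun n ↦ ?_
  rw [Set.mem_prod]
  refine ⟨?_, Set.mem_univ _⟩
  rcases cornerOrbit_inv hc₀ n with h | ⟨e, he, hxe⟩
  · exact D.zdBoundary_subset_meshDomain (D.zdArcA_subset_zdBoundary h)
  · exact mem_meshDomain_of_mem_bcBondConfig ω he hxe

include hD in
/-- **Re-entry happens only at the start corner.** If along the orbit of the start corner a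
non-inner face is followed by an inner one, the corner reached is the start corner: the step is
a crossing of a closed face-boundary edge at its `A`-end towards the domain, i.e. of a sourced
`A`–`B` edge, and there is only one (`existsUnique_startCorner`). [cite: Smirnov2001, §2] -/
theorem cornerOrbit_eq_startCorner_of_reentry {i : ℕ}
    (hout : ¬ D.IsInnerFace (cFace (cornerOrbit (D.bcBondConfig ω) (DiscreteDobrushin.startCorner hD) i)))
    (hin : D.IsInnerFace (cFace (cornerOrbit (D.bcBondConfig ω) (DiscreteDobrushin.startCorner hD) (i + 1)))) :
    cornerOrbit (D.bcBondConfig ω) (DiscreteDobrushin.startCorner hD) (i + 1) = DiscreteDobrushin.startCorner hD := by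
  set c₀ := DiscreteDobrushin.startCorner hD with hc₀def
  have hc₀ : D.IsStartCorner c₀ := DiscreteDobrushin.isStartCorner_startCorner hD
  set p := cornerOrbit (D.bcBondConfig ω) c₀ i with hp
  have hsucc : cornerOrbit (D.bcBondConfig ω) c₀ (i + 1) = nextCorner (D.bcBondConfig ω) p := rfl
  -- the step is a crossing of a closed edge
  have hclosed : cTgt p ∉ D.bcBondConfig ω := by
    intro h
    rw [hsucc, cFace_nextCorner_of_mem h] at hin
    exact hout hin
  rw [hsucc, nextCorner_of_not_mem hclosed] at hin ⊢
  -- `(p.1, p.2 + 1)` is a start corner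
  have hOut : D.IsOutEdge p.1 (p.2 + 1) := ⟨hin, by rw [fin4_add_one_add_three]; exact hout⟩
  obtain ⟨h1, h2⟩ := hD.arcs_cover_faceBoundary hOut.isFaceBoundaryEdge
  have hA : p.1 ∈ D.zdArcA := DiscreteDobrushin.mem_zdArcA_of_inv hD (cornerOrbit_inv hc₀ i) h1
  have hB : p.1 + cornerUnit (p.2 + 1) ∈ D.zdArcB := by
    rcases h2 with h2 | h2
    · refine absurd (DiscreteDobrushin.mem_bcBondConfig_of_arcA hOut.isFaceBoundaryEdge.1 ?_) hclosed
      intro x hx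
      rcases Sym2.mem_iff.1 hx with rfl | rfl
      · exact hA
      · exact h2
    · exact h2
  have huniq := DiscreteDobrushin.existsUnique_startCorner hD
  exact huniq.unique ⟨hA, hB, hOut⟩ ⟨hc₀.mem_zdArcA, hc₀.mem_zdArcB, hc₀.isOutEdge⟩

include hD in
/-- After the exit and before the return to the start corner, every face of the cycle is
non-inner (the cycle re-enters the inner faces only at the start corner). [cite: Smirnov2001, §2] -/
theorem not_isInnerFace_of_exitTime_le {n : ℕ}
    (hPmin : ∀ s, 0 < s → s < n + 1 →
      cornerOrbit (D.bcBondConfig ω) (DiscreteDobrushin.startCorner hD) s ≠ DiscreteDobrushin.startCorner hD)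
    {i : ℕ} (hi : DiscreteDobrushin.exitTime hD ω ≤ i) (hin : i ≤ n) :
    ¬ D.IsInnerFace (cFace (cornerOrbit (D.bcBondConfig ω) (DiscreteDobrushin.startCorner hD) i)) := by
  induction i with
  | zero =>
    have := DiscreteDobrushin.exitTime_pos hD ω
    omega
  | succ i ih =>
    intro hinner
    rcases Nat.eq_or_lt_of_le hi with heq | hlt
    · rw [← heq] at hinner
      exact DiscreteDobrushin.not_isInnerFace_exitTime hD ω hinner
    · have hout := ih (by omega) (by omega)
      have h := cornerOrbit_eq_startCorner_of_reentry hD ω hout hinner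
      exact hPmin (i + 1) (Nat.succ_pos i) (by omega) h

/-- **Within the wired arc, open-graph reachability**: the arc `A` is connected through `A`–`A`
edges of the domain (hypothesis (H1)), which are open in the completed configuration.
[cite: Smirnov2010, §4 (H1)] -/
theorem reachable_of_mem_zdArcA (hA1 : ((discreteDomainGraph D.Ω D.δ).induce D.zdArcA).Preconnected)
    {a a' : Site 2} (ha : a ∈ D.zdArcA) (ha' : a' ∈ D.zdArcA) :
    (Percolation.openGraph (D.bcBondConfig ω)).Reachable a a' := by
  let φ : (discreteDomainGraph D.Ω D.δ).induce D.zdArcA →g Percolation.openGraph (D.bcBondConfig ω) :=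
    { toFun := Subtype.val
      map_rel' := by
        intro u v huv
        rw [SimpleGraph.comap_adj, Function.Embedding.subtype_apply, Function.Embedding.subtype_apply] at huv
        rw [Percolation.openGraph_adj]
        refine ⟨DiscreteDobrushin.mem_bcBondConfig_of_arcA ((SimpleGraph.mem_edgeSet _).2 huv) ?_, huv.ne⟩
        intro x hx
        rcases Sym2.mem_iff.1 hx with rfl | rfl
        · exact u.2
        · exact v.2 }
  exact (hA1 ⟨a, ha⟩ ⟨a', ha'⟩).map φ

include hD in
/-- **The interface passes every free-arc dart of a site joined to the wired arc** (the tree's form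
of "`x` is connected to the wired arc iff the exploration path goes through the boundary edge at
`x`", Duminil-Copin–Hongler–Nolin 2011, proof of Lemma 12 / Duminil-Copin–Smirnov 2012, Prop. 7.8).
Let the wired arc be connected through the domain (H1), let `x` be a site joined by open edges
of the completed configuration to the arc `A`, and let `(x, k)` be a corner with inner face whose
face is joined to the face of the start corner by a chain of adjacent faces with closed common
sides (e.g. along the free arc). Then the interface visits the corner `(x, k)` before its exit.
Proof: the orbit of the start corner is a cycle of the turning rule in `ℤ²`; the winding number of
its closed perturbed polygon separates the start vertex from the start face
(`wind_cyLoop_fst_ne_faceCenter`), is constant on the open cluster of `x` (so equal at `x` and at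
the start vertex) and along the chain of faces (so equal at the two face centres); if `(x, k)`
were not on the cycle its half-diagonal would be missed and the winding numbers about `x` and
about its face centre would agree — a contradiction; and after the exit the cycle visits no
inner face before returning to the start corner. [cite: DuminilCopinHonglerNolin2011, §4, Lemma 12] -/
theorem exists_lt_exitTime_cornerOrbit_eq
    (hA1 : ((discreteDomainGraph D.Ω D.δ).induce D.zdArcA).Preconnected)
    {x : Site 2} {k : Fin 4} (hinner : D.IsInnerFace (faceAt x k))
    (hchain : Relation.ReflTransGen (fun f g : Site 2 ↦ (zdGraph 2).Adj f g ∧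
        ∀ u w : Site 2, IsCorner u f → IsCorner u g → IsCorner w f → IsCorner w g → u ≠ w →
          s(u, w) ∉ D.bcBondConfig ω)
        (cFace (DiscreteDobrushin.startCorner hD)) (faceAt x k))
    (hreach : ∃ a ∈ D.zdArcA, (Percolation.openGraph (D.bcBondConfig ω)).Reachable x a) :
    ∃ j < DiscreteDobrushin.exitTime hD ω,
      cornerOrbit (D.bcBondConfig ω) (DiscreteDobrushin.startCorner hD) j = (x, k) := by
  classical
  set c₀ := DiscreteDobrushin.startCorner hD with hc₀def
  have hc₀ : D.IsStartCorner c₀ := DiscreteDobrushin.isStartCorner_startCorner hD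
  set β := D.bcBondConfig ω with hβdef
  have hβ : β ⊆ (zdGraph 2).edgeSet := bcBondConfig_subset_zdGraph ω
  -- the minimal period
  have hex : ∃ P, 0 < P ∧ cornerOrbit β c₀ P = c₀ := exists_cornerOrbit_startCorner_eq hD ω
  obtain ⟨hP0, hP⟩ := Nat.find_spec hex
  have hPmin : ∀ s, 0 < s → s < Nat.find hex → cornerOrbit β c₀ s ≠ c₀ :=
    fun s hs hsP h ↦ Nat.find_min hex hsP ⟨hs, h⟩
  obtain ⟨n, hn⟩ : ∃ n, Nat.find hex = n + 1 := ⟨Nat.find hex - 1, by omega⟩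
  rw [hn] at hP hPmin
  -- winding numbers
  have hsep := wind_cyLoop_fst_ne_faceCenter hP hPmin
  obtain ⟨a, ha, hxa⟩ := hreach
  have hxc : (Percolation.openGraph β).Reachable x c₀.1 :=
    hxa.trans (reachable_of_mem_zdArcA ω hA1 ha hc₀.mem_zdArcA)
  have hwx := wind_cyLoop_eq_of_reachable hβ hP hxc
  have hwchain : ∀ g : Site 2, Relation.ReflTransGen (fun f g : Site 2 ↦ (zdGraph 2).Adj f g ∧
      ∀ u w : Site 2, IsCorner u f → IsCorner u g → IsCorner w f → IsCorner w g → u ≠ w →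
        s(u, w) ∉ β) (cFace c₀) g →
      wind (fun t => (cyLoop n hP).extend t - faceCenter (cFace c₀)) =
        wind (fun t => (cyLoop n hP).extend t - faceCenter g) := by
    intro g hg
    induction hg with
    | refl => rfl
    | tail _ hfg ih => exact ih.trans (wind_cyLoop_faceCenter_eq_of_adj hP hfg.1 hfg.2)
  have hwf := hwchain _ hchain
  -- if `(x, k)` were off the cycle
  by_contra hno
  push Not at hno
  have hne : ∀ m ≤ n, cornerOrbit β c₀ m ≠ (x, k) := by
    intro m hm h
    rcases lt_or_ge m (DiscreteDobrushin.exitTime hD ω) with hlt | hge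
    · exact hno m hlt h
    · have := not_isInnerFace_of_exitTime_le hD ω hPmin hge hm
      rw [h] at this
      exact this hinner
  have hwxf := wind_cyLoop_eq_faceCenter_of_forall_ne hP hne
  exact hsep (hwx.symm.trans (hwxf.trans hwf.symm))

end Domain

/-! ### Passage of the FK interface and connection to the wired arc -/

section Passage

variable {D : DiscreteDobrushin} (hD : D.IsZdAdmissible)

/-- The configuration-free chain relation between adjacent faces: every lattice edge joining two
common corners touches the free arc `B` (so it is closed in every completed configuration) — e.g.
consecutive faces along the free arc. [cite: Smirnov2001, §2] -/
def FreeSideAdj (D : DiscreteDobrushin) (f g : Site 2) : Prop :=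
  (zdGraph 2).Adj f g ∧ ∀ u w : Site 2, IsCorner u f → IsCorner u g → IsCorner w f → IsCorner w g → u ≠ w →
    (u ∈ D.zdArcB ∨ w ∈ D.zdArcB)

include hD in
/-- A `FreeSideAdj`-chain is a chain of faces with closed common sides in every completed
configuration. [cite: Smirnov2001, §2] -/
theorem reflTransGen_closed_of_freeSideAdj (ω : Percolation.BondConfig (Site 2)) {f g : Site 2}
    (h : Relation.ReflTransGen (FreeSideAdj D) f g) :
    Relation.ReflTransGen (fun f g : Site 2 ↦ (zdGraph 2).Adj f g ∧
      ∀ u w : Site 2, IsCorner u f → IsCorner u g → IsCorner w f → IsCorner w g → u ≠ w →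
        s(u, w) ∉ D.bcBondConfig ω) f g := by
  induction h with
  | refl => exact Relation.ReflTransGen.refl
  | tail _ hfg ih =>
    refine ih.tail ⟨hfg.1, fun u w h1 h2 h3 h4 hne ↦ ?_⟩
    rcases hfg.2 u w h1 h2 h3 h4 hne with hu | hw
    · exact DiscreteDobrushin.not_mem_bcBondConfig_of_mem_zdArcB hD (Sym2.mem_mk_left u w) hu
    · exact DiscreteDobrushin.not_mem_bcBondConfig_of_mem_zdArcB hD (Sym2.mem_mk_right u w) hw

/-- Adjacency in the interface graph implies adjacency in `Ω_δ` off the free arc (one direction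
of `DiscreteDobrushin.interfaceGraph_adj_iff` of `FKIsingBarToRectangle.lean`, reproved to keep the
imports light). [cite: Smirnov2010, §2.1] -/
theorem adj_and_not_mem_zdArcB_of_interfaceGraph_adj {v w : meshDomain D.Ω D.δ} (h : D.interfaceGraph.Adj v w) :
    (discreteDomainGraph D.Ω D.δ).Adj v.1 w.1 ∧ v.1 ∉ D.zdArcB ∧ w.1 ∉ D.zdArcB := by
  classical
  simp only [DiscreteDobrushin.interfaceGraph, domainSubgraph, SimpleGraph.deleteEdges_adj, SimpleGraph.comap_adj,
    Set.mem_setOf_eq, Sym2.mem_iff, not_exists, not_and] at h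
  obtain ⟨h, h'⟩ := h
  exact ⟨h, fun hv => h' v (Or.inl rfl) hv, fun hw => h' w (Or.inr rfl) hw⟩

/-- **Joined to the wired arc, in the two formalisms**: an `ω`-open path of the interface graph
from `x` to the arc `A` is an open path of the completed configuration. [cite: Smirnov2001, §2] -/
theorem exists_reachable_of_openJoinedToArcA {x : meshDomain D.Ω D.δ} {ω : Percolation.BondConfig (Site 2)}
    (h : DiscreteDobrushin.OpenJoinedToArcA D x ω) :
    ∃ a ∈ D.zdArcA, (Percolation.openGraph (D.bcBondConfig ω)).Reachable x.1 a := by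
  obtain ⟨b, hb, hreach⟩ := h
  let φ : SimpleGraph.fromEdgeSet {e' : Sym2 (meshDomain D.Ω D.δ) | e' ∈ D.interfaceGraph.edgeSet ∧
      Sym2.map Subtype.val e' ∈ ω} →g Percolation.openGraph (D.bcBondConfig ω) :=
    { toFun := Subtype.val
      map_rel' := by
        intro u v huv
        rw [SimpleGraph.fromEdgeSet_adj, Set.mem_setOf_eq, SimpleGraph.mem_edgeSet] at huv
        obtain ⟨⟨hadj, hω⟩, hne⟩ := huv
        obtain ⟨hdom, huB, hvB⟩ := adj_and_not_mem_zdArcB_of_interfaceGraph_adj hadj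
        rw [Percolation.openGraph_adj]
        refine ⟨⟨(SimpleGraph.mem_edgeSet _).2 hdom, Or.inr ⟨?_, ?_⟩⟩, fun h' ↦ hne (Subtype.ext h')⟩
        · simpa using hω
        · intro y hy
          rcases Sym2.mem_iff.1 hy with rfl | rfl
          · exact huB
          · exact hvB }
  exact ⟨b.1, hb, hreach.map φ⟩

include hD in
/-- **The interface passes the free-arc dart of every site joined to the wired arc, and only of
those** (Duminil-Copin–Hongler–Nolin 2011, proof of Lemma 12: "`e` belongs to `γ` if and only if
`x` is connected to the wired arc"; Duminil-Copin–Smirnov 2012, proof of Prop. 7.8). Here `q =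
(x, k)` is a corner with inner face whose source edge `{x, x + cornerUnit k}` ends on the free arc
`B`, the wired arc is connected through the domain (H1), and the face of `q` is joined to the
face of the start corner by a `FreeSideAdj`-chain (true along the free arc of the tree's box
domains). [cite: DuminilCopinHonglerNolin2011, §4, Lemma 12] -/
theorem cSrc_mem_fkInterface_iff_openJoinedToArcA [Fintype (meshDomain D.Ω D.δ)]
    (hA1 : ((discreteDomainGraph D.Ω D.δ).induce D.zdArcA).Preconnected)
    (q : Site 2 × Fin 4) (hqB : q.1 + cornerUnit q.2 ∈ D.zdArcB) (hx : q.1 ∈ meshDomain D.Ω D.δ)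
    (hinner : D.IsInnerFace (cFace q))
    (hchain : Relation.ReflTransGen (FreeSideAdj D) (cFace (DiscreteDobrushin.startCorner hD)) (cFace q))
    (ω : Percolation.BondConfig (Site 2)) :
    cSrc q ∈ fkInterface D ω ↔ DiscreteDobrushin.OpenJoinedToArcA D ⟨q.1, hx⟩ ω := by
  classical
  refine ⟨DiscreteDobrushin.openJoinedToArcA_of_mem_fkInterface hD q hqB hx, fun h ↦ ?_⟩
  obtain ⟨j, hj, hjq⟩ := exists_lt_exitTime_cornerOrbit_eq hD ω hA1 (x := q.1) (k := q.2) hinner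
    (reflTransGen_closed_of_freeSideAdj hD ω hchain) (exists_reachable_of_openJoinedToArcA (x := ⟨q.1, hx⟩) h)
  change cSrc q ∈ medialExploration D ω
  rw [DiscreteDobrushin.medialExploration_eq_explorationList hD, explorationList, List.mem_map]
  refine ⟨j, List.mem_range.2 (by omega), ?_⟩
  rw [hjq]

include hD in
/-- **The passage probability of a free-arc dart is the probability that its site is joined to
the wired arc**: `P(e ∈ γ) = P(x ↔ A)` (DCHN 2011, proof of Lemma 12; DCS 2012, Prop. 7.8).
[cite: DuminilCopinHonglerNolin2011, §4, Lemma 12] -/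
theorem real_cSrc_mem_fkInterface_eq_openJoined [Fintype (meshDomain D.Ω D.δ)]
    (hA1 : ((discreteDomainGraph D.Ω D.δ).induce D.zdArcA).Preconnected)
    (q : Site 2 × Fin 4) (hqB : q.1 + cornerUnit q.2 ∈ D.zdArcB) (hx : q.1 ∈ meshDomain D.Ω D.δ)
    (hinner : D.IsInnerFace (cFace q))
    (hchain : Relation.ReflTransGen (FreeSideAdj D) (cFace (DiscreteDobrushin.startCorner hD)) (cFace q)) :
    (fkDobrushinMeasure D).real {ω | cSrc q ∈ fkInterface D ω} =
      (fkDobrushinMeasure D).real {ω | DiscreteDobrushin.OpenJoinedToArcA D ⟨q.1, hx⟩ ω} := by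
  congr 1
  ext ω
  exact cSrc_mem_fkInterface_iff_openJoinedToArcA hD hA1 q hqB hx hinner hchain ω

end Passage

end Literature.Probability.LatticeModels
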